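import Literature.NumberTheory.Automorphic.HeckeFixedVectorsLift          -- ★ `eq_zero_of_heckeEquivariant_of_isEmpty_equiv`; brings ★ `HeckeFixedVectorsSimple` (`eq_fixedPoints_of_heckeOperator_stable`), ★ `HeckeAlgebra` (`heckeOperator`, `finite_orbit_quotient`)
import Literature.NumberTheory.Automorphic.HeckeEigencharacterPackage     -- ★ `Representation.levelAct_indicator_doubleCoset_apply` (`π(𝟙_{KgK}) = μ(K)·[KgK]`), ★ `isLevel_indicator_doubleCoset`; brings ★ `SmoothCharacter` (`Representation.levelActOp`, `IsLevel`)
import Literature.NumberTheory.Automorphic.IrrClassSchurHomZero           -- ★ `SmoothIrrep.isEmpty_equiv_of_mk_ne_mk` (distinct classes ⇒ no isomorphism); brings ★ `IrreducibleClasses` (`SmoothIrrep`, `IrrClass.mk`)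
import HarnessLib

/-!
# R90-TF · S4 «Ch. 13.1–2» · (W4-3) D-REP — RIGIDITY OF THE `K`-FIXED VECTORS OF IRREDUCIBLES UNDER THE OPERATORS `π(f)`, `f ∈ C_c(G // K)`:
# `V^K` has no proper non-zero `π(f)`-stable subspace, and non-isomorphic irreducibles admit no non-zero `π(f)`-intertwiner `V^K → W^K`

Cell `hodgecm-mathlib`, crux H413 (`stmt-HodgeConjecture-24833`, lane `--supports … --as helper`), route of record `HCCMUnconditional` (no route verbs;
count-neutral).  Programme R90-TF (brief `director/R90-BRIEF.v2.md` 1f40d54518340a35), section S4 = Rogawski Ch. 13.1–2 (dealer K2E2-plan (g6)); seat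
R90-C10-p03 (g0), dealt BY NAME «(W4-3) D-REP `Theorems/R90S4FixedVectorsIrreducibleRigidity.lean`» (deal wave S4-W4 «LI-G CHAIN», `R90/STATUS.md`
2026-09-04T21:59:08Z; heads of record `R90/S4/HEADS-S4-W4.K2E2-plan-g6.md` 64f10c13b0263844, §(W4-3)): hypotheses `hirr` (i) and `hrig` (ii) of the
Jacobson-density brick (W4-1) `R90S4SimultaneousRealisation` at `W j := (ρ j).fixedPoints K`, `gen j := fun f => (ρ j).levelActOp μ f.2.1 f.2.2`,
feeding (W4-5) `R90S4CharLinIndepOfHaar` (LI-G) and (W4-6) `R90S4TwistedCharSeparatesOfDensity` (LI-ε).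
THEOREMS ONLY (no `def`, no instance, no notation, no named fact, no `sorry`); ★-only `Literature` imports; Lines-free; generic over a topological group `G`
with a Borel measure `μ`, left-invariant and finite on compacts (the four instance binders `[IsTopologicalGroup G] [BorelSpace G] [μ.IsMulLeftInvariant]
[IsFiniteMeasureOnCompacts μ]` are those of ★ `Representation.levelActOp` itself), and a compact open subgroup `K` with `μ K ≠ 0` (automatic for a Haar
measure, §4).  RELATION TO THE TREE: ★ `SmoothTraceLinearIndependence` (`isSimpleModule_fixedPoints`, `nonempty_equiv_of_heckeEquivariant_fixedPoints`)
states (i)/(ii) in the `(heckeAlgebra ℂ G K)ᵐᵒᵖ`-module ∕ Hecke-operator currency; this file states them in the TEST-FUNCTION currency `π(f)|_{V^K}`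
(★ `levelActOp`), the `gen`-shape the free-algebra road (W4-1∕W4-2) consumes — no statement is restated verbatim.
HONEST LABEL: HC_CM is proved only modulo the 7 printed citations (2 remaining named inputs: hLiu418 = stmt-HodgeConjecture-24832, h413 =
stmt-HodgeConjecture-24833) until rung 0 closes; this file is a generic feeder of the (LI-G)/(LI-ε) chain and closes nothing global.

THE MATHEMATICS ([BushnellHenniart2006, §4.3 Proposition and §4.2 Corollary 1: `V ↦ V^K` is a bijection between irreducible smooth `V` with `V^K ≠ 0`
and simple `ℋ(G, K)`-modules]; [Bump1997, Prop. 4.2.3]; [CartierCorvallis1979, §IV.1: `[KgK] = μ(K)⁻¹ π(𝟙_{KgK})`]).  The tree holds both statements in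
the DOUBLE-COSET currency of the Hecke operators `[KgK] = Σ_{yK ⊆ KgK} ρ(y)` (★ `heckeOperator`): ★ `eq_fixedPoints_of_heckeOperator_stable` (`V^K` is
Hecke-simple for `ρ` irreducible) and ★ `eq_zero_of_heckeEquivariant_of_isEmpty_equiv` (no non-zero Hecke-equivariant `V^K → W^K` between
non-isomorphic irreducibles).  This file converts them to the TEST-FUNCTION currency `π(f)|_{V^K}` (★ `Representation.levelActOp μ hf hK`,
`f` compactly supported of level `K`) used by the trace `tr π(f) = tr (π(f)|_{V^K})` (★ `smoothTrace_eq_trace_levelActOp`): the dictionary is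
★ `levelAct_indicator_doubleCoset_apply` — `π(𝟙_{KgK}) = μ(K) · [KgK]` on `V^K`, with `𝟙_{KgK}` compactly supported of level `K`
(★ `isLevel_indicator_doubleCoset`) and `KgK/K` finite for `K` compact open (★ `finite_orbit_quotient` over ★ `isHeckeTriple_top_of_isCompact_isOpen`).
So a `π(f)`-stable subspace of `V^K` is `[KgK]`-stable, and a `π(f)`-intertwiner `V^K → W^K` (extended to `V` by a linear retraction `V → V^K`,
`LinearMap.exists_leftInverse_of_injective`, as in ★ `nonempty_equiv_of_heckeEquivariant_fixedPoints`) is Hecke-equivariant — whence (i) and (ii).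

CONTENTS (all generic; `ρ`, `σ` representations of `G` on complex vector spaces `V`, `W`).
* §1 dictionary: `measureReal_coe_ne_zero` (`(μ.real K : ℂ) ≠ 0` for `K` compact with `μ K ≠ 0`), `coe_levelActOp_indicator_doubleCoset`
  (`π(𝟙_{KgK})|_{V^K} v = μ(K) • [KgK] v`), `heckeOperator_eq_inv_smul_levelActOp_indicator` (`[KgK] v = μ(K)⁻¹ • π(𝟙_{KgK}) v`) and its `V^K`-valued
  form `mk_heckeOperator_eq_inv_smul_levelActOp_indicator`.
* §2 HEADS OF RECORD (HEADS-S4-W4 §(W4-3), binder-for-binder: `hfin`, `hμK : μ.real K ≠ 0`, `hKo`, `hKc`, generator-indexed hypotheses over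
  `{f : G → ℂ // HasCompactSupport f ∧ IsLevel K f}`): (i) **`fixedPoints_submodule_eq_bot_or_top_of_levelActOp_stable`** — for `ρ` irreducible every
  `π(f)|_{V^K}`-stable `p ≤ V^K` is `⊥` or `⊤`; (ii) **`eq_zero_of_levelActOp_comm_of_isEmpty_equiv`** — for `ρ`, `σ` irreducible with
  `IsEmpty (ρ.Equiv σ)`, every `φ : V^K →ₗ[ℂ] W^K` with `φ ∘ₗ π_ρ(f)|_{V^K} = π_σ(f)|_{W^K} ∘ₗ φ` for all such `f` is `0`.
* §3 CONVENIENCE FORMS (`hfin` derived from `K` compact open; `hμK : μ K ≠ 0`; explicit binders `f hf hK`): `eq_bot_or_eq_top_of_levelActOp_stable`,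
  `levelActOp_intertwiner_eq_zero_of_forall_apply` (pointwise hypothesis), `levelActOp_intertwiner_eq_zero` (`∘ₗ` hypothesis), CLASS form
  `SmoothIrrep.levelActOp_intertwiner_eq_zero_of_mk_ne_mk` (`IrrClass.mk r ≠ IrrClass.mk r′`, via ★ `SmoothIrrep.isEmpty_equiv_of_mk_ne_mk`).
* §4 Haar corollaries dropping `μ K ≠ 0` (`[μ.IsHaarMeasure]`: `K` is open and non-empty): `haar_subgroup_ne_zero`,
  `eq_bot_or_eq_top_of_levelActOp_stable_haar`, `levelActOp_intertwiner_eq_zero_haar`, `SmoothIrrep.levelActOp_intertwiner_eq_zero_of_mk_ne_mk_haar`.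

[cite: BushnellHenniart2006, §4.3 Proposition; §4.2 Corollary 1] [cite: Bump1997, Prop. 4.2.3 p. 427] [cite: CartierCorvallis1979, §IV.1]
[cite: GetzHahn2024, §8.5 Prop. 8.5.2 p. 160 (proof)] [cite: Rogawski1990, §13.2 Thm. 13.2.1 p. 200 («linear independence of characters»); §12.5 p. 182]
-/

set_option autoImplicit false
-- the mandated namespace repeats the single-problem summit's segment (`HodgeConjecture.HodgeConjecture`)
set_option linter.dupNamespace false

noncomputable section

open MeasureTheory MulAction
open Literature.NumberTheory.Automorphic

namespace Summit.HodgeConjecture.HodgeConjecture.R90.S4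

universe u

variable {G : Type u} [TopologicalSpace G] [Group G] [IsTopologicalGroup G] [MeasurableSpace G] [BorelSpace G]
  {V W : Type*} [AddCommGroup V] [Module ℂ V] [AddCommGroup W] [Module ℂ W]
  (ρ : Representation ℂ G V) (σ : Representation ℂ G W)

/-! ## §1 The dictionary `π(𝟙_{KgK})|_{V^K} = μ(K) · [KgK]` -/

section Dictionary

variable (μ : Measure G) {K : Subgroup G}

omit [IsTopologicalGroup G] [BorelSpace G] in
/-- `(μ.real K : ℂ) ≠ 0` for a compact `K` with `μ K ≠ 0` and `μ` finite on compacts (`μ.real K = (μ K).toReal` with `0 < μ K < ∞`). [folklore] -/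
theorem measureReal_coe_ne_zero [IsFiniteMeasureOnCompacts μ] (hKc : IsCompact (K : Set G)) (hμK : μ (K : Set G) ≠ 0) :
    (μ.real (K : Set G) : ℂ) ≠ 0 := by
  rw [Ne, Complex.ofReal_eq_zero, measureReal_def, ENNReal.toReal_eq_zero_iff, not_or]
  exact ⟨hμK, hKc.measure_lt_top.ne⟩

variable [μ.IsMulLeftInvariant] [IsFiniteMeasureOnCompacts μ]

/-- **`π(𝟙_{KgK})|_{V^K} v = μ(K) • [KgK] v`** for `K` compact open, `KgK/K` finite and `v ∈ V^K`: the level-`K` operator ★ `Representation.levelActOp`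
of the indicator of the double coset `KgK` (compactly supported of level `K`, ★ `isLevel_indicator_doubleCoset`) is `μ(K)` times the Hecke operator
★ `heckeOperator` (★ `levelAct_indicator_doubleCoset_apply`). [cite: CartierCorvallis1979, §IV.1] [cite: BushnellHenniart2006, §4.2] -/
theorem coe_levelActOp_indicator_doubleCoset (hKo : IsOpen (K : Set G)) (hKc : IsCompact (K : Set G)) (g : G)
    (hg : (orbit K (g : G ⧸ K)).Finite) (v : ρ.fixedPoints K) :
    (ρ.levelActOp μ (isLevel_indicator_doubleCoset hKo hKc g).2 (isLevel_indicator_doubleCoset hKo hKc g).1 v : V) =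
      (μ.real (K : Set G) : ℂ) • heckeOperator ρ K g (v : V) := by
  rw [Representation.coe_levelActOp_apply, ρ.levelAct_indicator_doubleCoset_apply μ g hg]

/-- **`[KgK] v = μ(K)⁻¹ • π(𝟙_{KgK})|_{V^K} v`** for `K` compact open with `μ.real K ≠ 0`, `KgK/K` finite and `v ∈ V^K` (Cartier's normalisation
`[KgK] = μ(K)⁻¹ π(𝟙_{KgK})`). [cite: CartierCorvallis1979, §IV.1] -/
theorem heckeOperator_eq_inv_smul_levelActOp_indicator (hKo : IsOpen (K : Set G)) (hKc : IsCompact (K : Set G))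
    (hμK : μ.real (K : Set G) ≠ 0) (g : G) (hg : (orbit K (g : G ⧸ K)).Finite) (v : ρ.fixedPoints K) :
    heckeOperator ρ K g (v : V) =
      (μ.real (K : Set G) : ℂ)⁻¹ •
        (ρ.levelActOp μ (isLevel_indicator_doubleCoset hKo hKc g).2 (isLevel_indicator_doubleCoset hKo hKc g).1 v : V) := by
  rw [coe_levelActOp_indicator_doubleCoset ρ μ hKo hKc g hg v, smul_smul, inv_mul_cancel₀ (Complex.ofReal_ne_zero.2 hμK), one_smul]

/-- The Hecke operator `[KgK]` as an element of `V^K`: `⟨[KgK] v, _⟩ = μ(K)⁻¹ • π(𝟙_{KgK})|_{V^K} v` (`K` compact open, `μ.real K ≠ 0`, `KgK/K` finite).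
[cite: CartierCorvallis1979, §IV.1] -/
theorem mk_heckeOperator_eq_inv_smul_levelActOp_indicator (hKo : IsOpen (K : Set G)) (hKc : IsCompact (K : Set G))
    (hμK : μ.real (K : Set G) ≠ 0) (g : G) (hg : (orbit K (g : G ⧸ K)).Finite) (v : ρ.fixedPoints K)
    (hTv : heckeOperator ρ K g (v : V) ∈ ρ.fixedPoints K) :
    (⟨heckeOperator ρ K g (v : V), hTv⟩ : ρ.fixedPoints K) =
      (μ.real (K : Set G) : ℂ)⁻¹ •
        ρ.levelActOp μ (isLevel_indicator_doubleCoset hKo hKc g).2 (isLevel_indicator_doubleCoset hKo hKc g).1 v := by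
  apply Subtype.ext
  rw [Submodule.coe_smul]
  exact heckeOperator_eq_inv_smul_levelActOp_indicator ρ μ hKo hKc hμK g hg v

end Dictionary

/-! ## §2 Heads of record (HEADS-S4-W4 §(W4-3)): (i) `hirr` and (ii) `hrig` at `gen := fun f => ρ.levelActOp μ f.2.1 f.2.2` -/

section HeadsOfRecord

/-- **(i) `V^K` HAS NO PROPER NON-ZERO `π(f)`-STABLE SUBSPACE** (Bushnell–Henniart §4.3 Proposition with §4.2 Corollary 1; Bump, Prop. 4.2.3) — head of
record (W4-3)(i).  Let `ρ` be an irreducible representation of `G` on a complex vector space, `K` a compact open subgroup all of whose double cosets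
`KgK` are finite unions of left cosets (`hfin`, e.g. ★ `finite_orbit_quotient`), `μ` a left-invariant Borel measure finite on compacts with
`μ.real K ≠ 0`.  If `p ≤ V^K` is stable under `π(f)|_{V^K}` (★ `Representation.levelActOp μ f.2.1 f.2.2`) for every level-`K` test function
`f : {f : G → ℂ // HasCompactSupport f ∧ IsLevel K f}`, then `p = ⊥` or `p = ⊤`.  Proof: `p` read in `V` is stable under every Hecke operator
`[KgK] = μ(K)⁻¹ π(𝟙_{KgK})` (§1), so ★ `eq_fixedPoints_of_heckeOperator_stable` applies.
[cite: BushnellHenniart2006, §4.3 Proposition] [cite: Bump1997, Prop. 4.2.3 p. 427] -/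
theorem fixedPoints_submodule_eq_bot_or_top_of_levelActOp_stable [ρ.IsIrreducible] (μ : Measure G) [μ.IsMulLeftInvariant]
    [IsFiniteMeasureOnCompacts μ] {K : Subgroup G} (hfin : ∀ g : G, (orbit K (g : G ⧸ K)).Finite) (hμK : μ.real (K : Set G) ≠ 0)
    (hKo : IsOpen (K : Set G)) (hKc : IsCompact (K : Set G)) (p : Submodule ℂ (ρ.fixedPoints K))
    (hp : ∀ f : {f : G → ℂ // HasCompactSupport f ∧ IsLevel K f}, ∀ w ∈ p, ρ.levelActOp μ f.2.1 f.2.2 w ∈ p) :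
    p = ⊥ ∨ p = ⊤ := by
  classical
  rcases eq_or_ne p ⊥ with hbot | hbot
  · exact Or.inl hbot
  refine Or.inr ?_
  -- `p` read inside `V`
  have hWK : p.map (ρ.fixedPoints K).subtype ≤ ρ.fixedPoints K := Submodule.map_subtype_le _ _
  have hW0 : p.map (ρ.fixedPoints K).subtype ≠ ⊥ := by
    intro h
    apply hbot
    rw [← Submodule.map_bot (ρ.fixedPoints K).subtype] at h
    exact Submodule.map_injective_of_injective (ρ.fixedPoints K).injective_subtype h
  have hstab : ∀ g : G, ∀ w ∈ p.map (ρ.fixedPoints K).subtype, heckeOperator ρ K g w ∈ p.map (ρ.fixedPoints K).subtype := by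
    rintro g _ ⟨w, hw, rfl⟩
    refine ⟨(μ.real (K : Set G) : ℂ)⁻¹ •
        ρ.levelActOp μ (isLevel_indicator_doubleCoset hKo hKc g).2 (isLevel_indicator_doubleCoset hKo hKc g).1 w,
      p.smul_mem _ (hp ⟨_, (isLevel_indicator_doubleCoset hKo hKc g).2, (isLevel_indicator_doubleCoset hKo hKc g).1⟩ w hw), ?_⟩
    change (((μ.real (K : Set G) : ℂ)⁻¹ •
        ρ.levelActOp μ (isLevel_indicator_doubleCoset hKo hKc g).2 (isLevel_indicator_doubleCoset hKo hKc g).1 w :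
          ρ.fixedPoints K) : V) = heckeOperator ρ K g (w : V)
    rw [Submodule.coe_smul]
    exact (heckeOperator_eq_inv_smul_levelActOp_indicator ρ μ hKo hKc hμK g (hfin g) w).symm
  have hW := eq_fixedPoints_of_heckeOperator_stable ρ K hfin hWK hW0 hstab
  have hW' : p.map (ρ.fixedPoints K).subtype = (⊤ : Submodule ℂ (ρ.fixedPoints K)).map (ρ.fixedPoints K).subtype := by
    rw [hW, Submodule.map_subtype_top]
  exact Submodule.map_injective_of_injective (ρ.fixedPoints K).injective_subtype hW'

/-- **(ii) RIGIDITY: A `π(f)`-INTERTWINER `V^K → W^K` BETWEEN NON-ISOMORPHIC IRREDUCIBLES IS ZERO** (Bushnell–Henniart §4.3 Proposition: `V ↦ V^K` is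
injective on isomorphism classes of irreducibles with `V^K ≠ 0`; Bump, Prop. 4.2.3) — head of record (W4-3)(ii).  Let `ρ`, `σ` be irreducible with
`IsEmpty (ρ.Equiv σ)`, `K` compact open with finite double cosets (`hfin`), `μ` left-invariant, finite on compacts, `μ.real K ≠ 0`, and
`φ : V^K →ₗ[ℂ] W^K` with `φ ∘ₗ π_ρ(f)|_{V^K} = π_σ(f)|_{W^K} ∘ₗ φ` for every level-`K` test function `f`.  Then `φ = 0`.  Proof: extend `φ` to
`Φ = ι_W ∘ φ ∘ r : V →ₗ W` along a linear retraction `r : V → V^K` (`LinearMap.exists_leftInverse_of_injective`); on `V^K`, `Φ` commutes with every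
`[KgK] = μ(K)⁻¹ π(𝟙_{KgK})` (§1), so ★ `eq_zero_of_heckeEquivariant_of_isEmpty_equiv` kills it on `V^K`, i.e. `φ = 0`.
[cite: BushnellHenniart2006, §4.3 Proposition] [cite: Bump1997, Prop. 4.2.3 p. 427] -/
theorem eq_zero_of_levelActOp_comm_of_isEmpty_equiv [ρ.IsIrreducible] [σ.IsIrreducible] (hne : IsEmpty (ρ.Equiv σ))
    (μ : Measure G) [μ.IsMulLeftInvariant] [IsFiniteMeasureOnCompacts μ] {K : Subgroup G}
    (hfin : ∀ g : G, (orbit K (g : G ⧸ K)).Finite) (hμK : μ.real (K : Set G) ≠ 0)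
    (hKo : IsOpen (K : Set G)) (hKc : IsCompact (K : Set G)) (φ : ρ.fixedPoints K →ₗ[ℂ] σ.fixedPoints K)
    (hφ : ∀ f : {f : G → ℂ // HasCompactSupport f ∧ IsLevel K f},
      φ ∘ₗ ρ.levelActOp μ f.2.1 f.2.2 = σ.levelActOp μ f.2.1 f.2.2 ∘ₗ φ) :
    φ = 0 := by
  classical
  -- a linear retraction `r : V → V^K` and the total extension `Φ = ι ∘ φ ∘ r`
  obtain ⟨r, hr⟩ := (ρ.fixedPoints K).subtype.exists_leftInverse_of_injective (Submodule.ker_subtype _)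
  have hrv : ∀ v : ρ.fixedPoints K, r (v : V) = v := fun v => by
    rw [← Submodule.coe_subtype, ← LinearMap.comp_apply, hr, LinearMap.id_apply]
  set Φ : V →ₗ[ℂ] W := (σ.fixedPoints K).subtype ∘ₗ φ ∘ₗ r with hΦdef
  have hΦv : ∀ v : ρ.fixedPoints K, Φ (v : V) = (φ v : W) := fun v => by
    rw [hΦdef, LinearMap.comp_apply, LinearMap.comp_apply, hrv, Submodule.coe_subtype]
  have hΦK : ∀ v ∈ ρ.fixedPoints K, Φ v ∈ σ.fixedPoints K := fun v hv => by
    rw [hΦv ⟨v, hv⟩]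
    exact (φ ⟨v, hv⟩).2
  have hΦT : ∀ g : G, ∀ v ∈ ρ.fixedPoints K, Φ (heckeOperator ρ K g v) = heckeOperator σ K g (Φ v) := by
    intro g v hv
    have hTv : heckeOperator ρ K g v ∈ ρ.fixedPoints K := heckeOperator_apply_mem_fixedPoints ρ K g hv (hfin g)
    have hφg := hφ ⟨_, (isLevel_indicator_doubleCoset hKo hKc g).2, (isLevel_indicator_doubleCoset hKo hKc g).1⟩
    rw [hΦv ⟨v, hv⟩, ← Submodule.coe_mk (heckeOperator ρ K g v) hTv, hΦv ⟨_, hTv⟩,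
      mk_heckeOperator_eq_inv_smul_levelActOp_indicator ρ μ hKo hKc hμK g (hfin g) ⟨v, hv⟩ hTv, map_smul,
      ← LinearMap.comp_apply, hφg, LinearMap.comp_apply, Submodule.coe_smul,
      ← heckeOperator_eq_inv_smul_levelActOp_indicator σ μ hKo hKc hμK g (hfin g) (φ ⟨v, hv⟩)]
  have h0 := eq_zero_of_heckeEquivariant_of_isEmpty_equiv ρ σ K hfin hne Φ hΦK hΦT
  ext v
  rw [LinearMap.zero_apply, Submodule.coe_zero, ← hΦv v]
  exact h0 v v.2

end HeadsOfRecord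

/-! ## §3 Convenience forms: `K` compact open supplies `hfin`; `μ K ≠ 0`; explicit binders `f hf hK` -/

section Convenience

variable (μ : Measure G) [μ.IsMulLeftInvariant] [IsFiniteMeasureOnCompacts μ] {K : Subgroup G}

/-- (i) for `K` compact open with `μ K ≠ 0` and explicit binders: every subspace `N ≤ V^K` stable under all `π(f)|_{V^K}` (`f` compactly supported of
level `K`) is `⊥` or `⊤` for `ρ` irreducible (finite double cosets by ★ `finite_orbit_quotient` over ★ `isHeckeTriple_top_of_isCompact_isOpen`).
[cite: BushnellHenniart2006, §4.3 Proposition] [cite: Bump1997, Prop. 4.2.3 p. 427] -/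
theorem eq_bot_or_eq_top_of_levelActOp_stable [ρ.IsIrreducible] (hKo : IsOpen (K : Set G)) (hKc : IsCompact (K : Set G))
    (hμK : μ (K : Set G) ≠ 0) (N : Submodule ℂ (ρ.fixedPoints K))
    (hN : ∀ (f : G → ℂ) (hf : HasCompactSupport f) (hK : IsLevel K f), ∀ w ∈ N, ρ.levelActOp μ hf hK w ∈ N) :
    N = ⊥ ∨ N = ⊤ :=
  haveI := isHeckeTriple_top_of_isCompact_isOpen K hKc hKo
  fixedPoints_submodule_eq_bot_or_top_of_levelActOp_stable ρ μ (finite_orbit_quotient K)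
    (Complex.ofReal_ne_zero.1 (measureReal_coe_ne_zero μ hKc hμK)) hKo hKc N fun f => hN f.1 f.2.1 f.2.2

/-- (ii) for `K` compact open with `μ K ≠ 0`, POINTWISE hypothesis: for `ρ`, `σ` irreducible with `IsEmpty (ρ.Equiv σ)`, every `φ : V^K →ₗ[ℂ] W^K`
with `φ (π_ρ(f) v) = π_σ(f) (φ v)` for all compactly supported `f` of level `K` and all `v ∈ V^K` is `0`.
[cite: BushnellHenniart2006, §4.3 Proposition] [cite: Bump1997, Prop. 4.2.3 p. 427] -/
theorem levelActOp_intertwiner_eq_zero_of_forall_apply [ρ.IsIrreducible] [σ.IsIrreducible] (hne : IsEmpty (ρ.Equiv σ))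
    (hKo : IsOpen (K : Set G)) (hKc : IsCompact (K : Set G)) (hμK : μ (K : Set G) ≠ 0)
    (φ : ρ.fixedPoints K →ₗ[ℂ] σ.fixedPoints K)
    (hφ : ∀ (f : G → ℂ) (hf : HasCompactSupport f) (hK : IsLevel K f) (v : ρ.fixedPoints K),
      φ (ρ.levelActOp μ hf hK v) = σ.levelActOp μ hf hK (φ v)) :
    φ = 0 :=
  haveI := isHeckeTriple_top_of_isCompact_isOpen K hKc hKo
  eq_zero_of_levelActOp_comm_of_isEmpty_equiv ρ σ hne μ (finite_orbit_quotient K)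
    (Complex.ofReal_ne_zero.1 (measureReal_coe_ne_zero μ hKc hμK)) hKo hKc φ
    fun f => LinearMap.ext fun v => hφ f.1 f.2.1 f.2.2 v

/-- (ii) for `K` compact open with `μ K ≠ 0`, OPERATOR hypothesis with explicit binders: every `φ : V^K →ₗ[ℂ] W^K` with
`φ ∘ₗ π_ρ(f)|_{V^K} = π_σ(f)|_{W^K} ∘ₗ φ` for all compactly supported `f` of level `K` is `0` (`ρ`, `σ` irreducible, `IsEmpty (ρ.Equiv σ)`).
[cite: BushnellHenniart2006, §4.3 Proposition] [cite: Bump1997, Prop. 4.2.3 p. 427] -/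
theorem levelActOp_intertwiner_eq_zero [ρ.IsIrreducible] [σ.IsIrreducible] (hne : IsEmpty (ρ.Equiv σ))
    (hKo : IsOpen (K : Set G)) (hKc : IsCompact (K : Set G)) (hμK : μ (K : Set G) ≠ 0)
    (φ : ρ.fixedPoints K →ₗ[ℂ] σ.fixedPoints K)
    (hφ : ∀ (f : G → ℂ) (hf : HasCompactSupport f) (hK : IsLevel K f),
      φ ∘ₗ ρ.levelActOp μ hf hK = σ.levelActOp μ hf hK ∘ₗ φ) :
    φ = 0 :=
  levelActOp_intertwiner_eq_zero_of_forall_apply ρ σ μ hne hKo hKc hμK φ fun f hf hK v => by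
    rw [← LinearMap.comp_apply, hφ f hf hK, LinearMap.comp_apply]

/-- **(ii), CLASS form**: for bundled irreducible smooth representations `r`, `r′` with DIFFERENT classes `IrrClass.mk r ≠ IrrClass.mk r′`
(★ `SmoothIrrep.isEmpty_equiv_of_mk_ne_mk`), every `π(f)`-intertwiner `r.ρ.fixedPoints K →ₗ[ℂ] r′.ρ.fixedPoints K` is `0` (`K` compact open,
`μ K ≠ 0`) — the shape met at representatives of distinct admissible classes. [cite: BushnellHenniart2006, §4.3 Proposition; §2.6] -/
theorem SmoothIrrep.levelActOp_intertwiner_eq_zero_of_mk_ne_mk (r r' : SmoothIrrep G) (hne : IrrClass.mk r ≠ IrrClass.mk r')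
    (hKo : IsOpen (K : Set G)) (hKc : IsCompact (K : Set G)) (hμK : μ (K : Set G) ≠ 0)
    (φ : r.ρ.fixedPoints K →ₗ[ℂ] r'.ρ.fixedPoints K)
    (hφ : ∀ (f : G → ℂ) (hf : HasCompactSupport f) (hK : IsLevel K f) (v : r.ρ.fixedPoints K),
      φ (r.ρ.levelActOp μ hf hK v) = r'.ρ.levelActOp μ hf hK (φ v)) :
    φ = 0 :=
  levelActOp_intertwiner_eq_zero_of_forall_apply r.ρ r'.ρ μ (SmoothIrrep.isEmpty_equiv_of_mk_ne_mk r r' hne)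
    hKo hKc hμK φ hφ

end Convenience

/-! ## §4 Haar corollaries (`μ K ≠ 0` is automatic) -/

section Haar

variable (μ : Measure G) [μ.IsHaarMeasure] {K : Subgroup G}

omit [IsTopologicalGroup G] [BorelSpace G] in
/-- A compact open subgroup has non-zero Haar measure (it is open and contains `1`). [folklore] -/
theorem haar_subgroup_ne_zero (hKo : IsOpen (K : Set G)) : μ (K : Set G) ≠ 0 :=
  hKo.measure_ne_zero μ ⟨1, K.one_mem⟩

/-- (i) for a Haar measure: every `π(f)|_{V^K}`-stable subspace of `V^K` (`f` compactly supported of level `K`, `K` compact open) is `⊥` or `⊤`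
for `ρ` irreducible. [cite: BushnellHenniart2006, §4.3 Proposition] [cite: Bump1997, Prop. 4.2.3 p. 427] -/
theorem eq_bot_or_eq_top_of_levelActOp_stable_haar [ρ.IsIrreducible] (hKo : IsOpen (K : Set G)) (hKc : IsCompact (K : Set G))
    (N : Submodule ℂ (ρ.fixedPoints K))
    (hN : ∀ (f : G → ℂ) (hf : HasCompactSupport f) (hK : IsLevel K f), ∀ w ∈ N, ρ.levelActOp μ hf hK w ∈ N) :
    N = ⊥ ∨ N = ⊤ :=
  eq_bot_or_eq_top_of_levelActOp_stable ρ μ hKo hKc (haar_subgroup_ne_zero μ hKo) N hN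

/-- (ii) for a Haar measure: a `π(f)`-intertwiner `V^K → W^K` between non-isomorphic irreducibles is `0` (`K` compact open).
[cite: BushnellHenniart2006, §4.3 Proposition] [cite: Bump1997, Prop. 4.2.3 p. 427] -/
theorem levelActOp_intertwiner_eq_zero_haar [ρ.IsIrreducible] [σ.IsIrreducible] (hne : IsEmpty (ρ.Equiv σ))
    (hKo : IsOpen (K : Set G)) (hKc : IsCompact (K : Set G)) (φ : ρ.fixedPoints K →ₗ[ℂ] σ.fixedPoints K)
    (hφ : ∀ (f : G → ℂ) (hf : HasCompactSupport f) (hK : IsLevel K f) (v : ρ.fixedPoints K),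
      φ (ρ.levelActOp μ hf hK v) = σ.levelActOp μ hf hK (φ v)) :
    φ = 0 :=
  levelActOp_intertwiner_eq_zero_of_forall_apply ρ σ μ hne hKo hKc (haar_subgroup_ne_zero μ hKo) φ hφ

/-- (ii), CLASS form, for a Haar measure: representatives of distinct classes admit no non-zero `π(f)`-intertwiner on `K`-fixed vectors.
[cite: BushnellHenniart2006, §4.3 Proposition; §2.6] -/
theorem SmoothIrrep.levelActOp_intertwiner_eq_zero_of_mk_ne_mk_haar (r r' : SmoothIrrep G) (hne : IrrClass.mk r ≠ IrrClass.mk r')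
    (hKo : IsOpen (K : Set G)) (hKc : IsCompact (K : Set G)) (φ : r.ρ.fixedPoints K →ₗ[ℂ] r'.ρ.fixedPoints K)
    (hφ : ∀ (f : G → ℂ) (hf : HasCompactSupport f) (hK : IsLevel K f) (v : r.ρ.fixedPoints K),
      φ (r.ρ.levelActOp μ hf hK v) = r'.ρ.levelActOp μ hf hK (φ v)) :
    φ = 0 :=
  SmoothIrrep.levelActOp_intertwiner_eq_zero_of_mk_ne_mk μ r r' hne hKo hKc (haar_subgroup_ne_zero μ hKo) φ hφ

end Haar

end Summit.HodgeConjecture.HodgeConjecture.R90.S4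

end
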